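import Literature.AlgebraicGeometry.HodgeTheory.BettiHodgeConjectureProductOfSurfaces
import HarnessLib

/-!
# The Hodge classes of a product of two threefolds and `HC(T × T')` in the language of morphisms of Hodge structures: the five pieces of `H⁴(T × T')` and the seven pieces of
# `H⁶(T × T')` (`dim_ℚ Hdg³(H⁶(T × T')) = 2 + dim Hom_HS(H¹(T), H⁵(T')(2)) + dim Hom_HS(H²(T), H⁴(T')(1)) + dim Hom_HS(H³(T), H³(T')) + dim Hom_HS(H⁴(T), H²(T')(−1)) + dim Hom_HS(H⁵(T), H¹(T')(−2))`),
# and `HC(T × T')` as soon as none of these pieces carries more morphisms than the products of Hodge classes of the factors (Voisin I §11.3.3 Thm. 11.38, Lemma 11.41 p. 286, p. 287; Deligne 2000 §1)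

Family `hodge`, lane `lit-hodgefound` (Track 2 foundations library; Layers A1/A4), layer `Literature/AlgebraicGeometry/HodgeTheory`.  THEOREMS ONLY (no definition,
no named fact, no instance; D-0026 net debt `0`).  Sequel of the seat's g27-#9 (`S × S'`), g27-#11 (`S × T`) and g27-#10 (`T × T'` with `T'` pure-even): here the general sixfold `T × T'` of
two smooth projective threefolds, middle codimensions `2` AND `3`.  `H⁴(T ⊗ T')` has the five Künneth pieces of g27-#11 (with `Hdg²(H⁴(T))` in place of the surface's `1`), and `H⁶(T ⊗ T')` the
seven pieces `H⁰ ⊗ H⁶`, `H¹ ⊗ H⁵`, `H² ⊗ H⁴`, `H³ ⊗ H³`, `H⁴ ⊗ H²`, `H⁵ ⊗ H¹`, `H⁶ ⊗ H⁰`, whose Hodge classes are (Lemma 11.41, g27-#7) the morphisms `H¹(T) → H⁵(T')(2)`, `H²(T) → H⁴(T')(1)`,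
`H³(T) → H³(T')`, `H⁴(T) → H²(T')(−1)`, `H⁵(T) → H¹(T')(−2)`, and two lines.  g27-#1's criterion asks, in codimension `3`, for `dim = 1·1 + ρ(T)·dim Hdg²(H⁴(T')) + dim Hdg²(H⁴(T))·ρ(T') + 1·1`;
the even pieces always carry at least the rank-one morphisms through Hodge classes (g27-#7 §2), so `HC(T × T')` follows (with `HC` in dimension `3`) from: the three odd `Hom` of `H⁶` and the two of
`H⁴` vanish, and the three even `Hom` (`H² → H²'`, `H² → H⁴'(1)`, `H⁴ → H²'(−1)`) are not larger than `ρρ'`, `ρ · dim Hdg²(H⁴')`, `dim Hdg²(H⁴) · ρ'` — e.g. two threefolds with `q = 0` and no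
transcendental morphisms in degrees `2`/`4` and none `H³(T) → H³(T')` (g27-#10 is the case `T'` pure-even, where the even conditions are automatic).

THE PRINTS.  C. Voisin (2002) [VoisinHodgeI2002] §11.3.3 (held text p0236–p0237 = pp. 285–287): Thm. 11.38, Thm. 11.40, Lemma 11.41, p. 287; Thm. 11.30, §6.2.3 Thm. 6.25.  P. Deligne (1971)
[DeligneHodgeII1971] 2.1.13–2.1.14.  P. Deligne (2000) [Deligne2000] §1.

THE OBJECTS (all the tree's).  `Hdgᵖ(Hᵏ(X)) = (BettiUniverse.hodge hHD hX k).hodgeClasses p`, `ρ = dim_ℚ Hdg¹(H²)`; `HodgeStructure.Hom`, `tateTwist`, `cast`; `HodgeConjectureFor`; `[HodgeTensorFacts.{0, 0}]`.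

WHAT IS PROVED.
* `dim_ℚ Hdg³(H⁶(T)) = 1` for a threefold (`BettiUniverse.finrank_hodgeClasses_hodge_six_threefold`).
* **`dim_ℚ Hdg²(H⁴(T ⊗ T')) = dim Hdg²(H⁴(T')) + dim Hom_HS(H¹(T), H³(T')(1)) + dim Hom_HS(H²(T), H²(T')) + dim Hom_HS(H³(T), H¹(T')(−1)) + dim Hdg²(H⁴(T))`**
  (`BettiUniverse.finrank_hodgeClasses_hodge_four_tensor_threefolds`).
* **`dim_ℚ Hdg³(H⁶(T ⊗ T')) = 1 + dim Hom_HS(H¹(T), H⁵(T')(2)) + dim Hom_HS(H²(T), H⁴(T')(1)) + dim Hom_HS(H³(T), H³(T')) + dim Hom_HS(H⁴(T), H²(T')(−1)) + dim Hom_HS(H⁵(T), H¹(T')(−2)) + 1`**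
  (`BettiUniverse.finrank_hodgeClasses_hodge_six_tensor_threefolds`); any smooth-projective structure on the product.
* **`HC(T ⊗ T')`** when the five odd `Hom` vanish and `dim Hom_HS(H²(T), H²(T')) ≤ ρρ'`, `dim Hom_HS(H²(T), H⁴(T')(1)) ≤ ρ(T) · dim Hdg²(H⁴(T'))`, `dim Hom_HS(H⁴(T), H²(T')(−1)) ≤ dim Hdg²(H⁴(T)) · ρ(T')`
  (`BettiUniverse.hodgeConjectureFor_tensor_threefolds_of_hom`), and the case `q(T) = q(T') = 0`, where four of the five odd conditions are automatic (`BettiUniverse.hodgeConjectureFor_tensor_threefolds_of_q_zero_of_hom`).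

DEVIATIONS / SCOPE.  Hard Lefschetz (`H⁴(T') ≅ H²(T')(−1)`) would identify the `H² → H⁴'(1)` and `H⁴ → H²'(−1)` conditions with the `H² → H²'` one; not done here (the three are kept separate).
`T × T` is not covered (`Id ∈ Hom_HS(H³(T), H³(T))`).

## References
* [VoisinHodgeI2002] C. Voisin, *Hodge Theory and Complex Algebraic Geometry I* (2002) — §11.3.3 Thm. 11.38, Thm. 11.40, Lemma 11.41 (p. 286), p. 287; Thm. 11.30; §6.2.3 Thm. 6.25.
* [DeligneHodgeII1971] P. Deligne, *Théorie de Hodge II*, Publ. Math. IHÉS 40 (1971) — 2.1.13–2.1.14.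
* [Deligne2000] P. Deligne, *The Hodge conjecture* (Clay, 2000) — §1.

## Provenance
Lane `lit-hodgefound` (Hodge path, Track 2), prover seat `lit-hodgefound-p29` (generation 27), self-proposed row g27-#12 (sequel of g27-#9/#10/#11).
-/

noncomputable section

open scoped TensorProduct
open CategoryTheory MonoidalCategory Module Finset
open Literature.AlgebraicTopology.SingularHomology
open Literature.Geometry.Kaehler

namespace Literature.AlgebraicGeometry.HodgeTheory

open Literature.AlgebraicGeometry.Motives
open Literature.AlgebraicGeometry.Motives.HodgeStructure

variable {d : ℕ} {T T' : SchemeOver ℂ}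

/-- **`Hdg³(H⁶(T)) = H⁶(T)` is a line for a smooth projective threefold** (`H⁶ = H^{3,3}`, dual to `H⁰`; `b₆ = 1`). [cite: VoisinHodgeI2002, §6.2.3 Thm. 6.25 and §11.3.1] -/
theorem BettiUniverse.finrank_hodgeClasses_hodge_six_threefold (hHD : exists_isReal_hodgeModel) (hT : IsSmoothProjective 3 T) :
    Module.finrank ℚ ↥((BettiUniverse.hodge hHD hT 6).hodgeClasses 3) = 1 := by
  have e : (BettiUniverse.hodge hHD hT (2 * 3)).hodgeClasses ((3 : ℕ) : ℤ) = ⊤ :=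
    (BettiUniverse.hodgeClasses_hodge_eq_top_iff_dual hHD hT (p := 3) (q := 0) (by norm_num)).2 (by simpa using BettiUniverse.hodgeClasses_hodge_zero_eq_top hHD hT)
  have t : Module.finrank ℚ ↥((BettiUniverse.hodge hHD hT (2 * 3)).hodgeClasses ((3 : ℕ) : ℤ)) = 1 := by
    rw [e, finrank_top]; exact BettiUniverse.finrank_bettiCohomology_top hT
  exact t

section Threefolds

variable [HodgeTensorFacts.{0, 0}]

/-! ### §1 The five pieces of `H⁴(T ⊗ T')` -/

/-- **`dim_ℚ Hdg²(H⁴(T ⊗ T')) = dim Hdg²(H⁴(T')) + dim Hom_HS(H¹(T), H³(T')(1)) + dim Hom_HS(H²(T), H²(T')) + dim Hom_HS(H³(T), H¹(T')(−1)) + dim Hdg²(H⁴(T))`** for two threefolds (any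
smooth-projective structure on the product). [cite: VoisinHodgeI2002, §11.3.3 Thm. 11.38, Thm. 11.40, Lemma 11.41 (pp. 285–286) and p. 287] [cite: DeligneHodgeII1971, 2.1.13–2.1.14] -/
theorem BettiUniverse.finrank_hodgeClasses_hodge_four_tensor_threefolds (hHD : exists_isReal_hodgeModel) (hT : IsSmoothProjective 3 T) (hT' : IsSmoothProjective 3 T')
    (hTT' : IsSmoothProjective d (T ⊗ T')) :
    Module.finrank ℚ ↥((BettiUniverse.hodge hHD hTT' 4).hodgeClasses 2) =
      Module.finrank ℚ ↥((BettiUniverse.hodge hHD hT' 4).hodgeClasses 2) +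
        Module.finrank ℚ (HodgeStructure.Hom (BettiUniverse.hodge hHD hT 1) (((BettiUniverse.hodge hHD hT' 3).tateTwist 1).cast (by norm_num))) +
          Module.finrank ℚ (HodgeStructure.Hom (BettiUniverse.hodge hHD hT 2) (BettiUniverse.hodge hHD hT' 2)) +
            Module.finrank ℚ (HodgeStructure.Hom (BettiUniverse.hodge hHD hT 3) (((BettiUniverse.hodge hHD hT' 1).tateTwist (-1)).cast (by norm_num))) +
              Module.finrank ℚ ↥((BettiUniverse.hodge hHD hT 4).hodgeClasses 2) := by
  have h := BettiUniverse.finrank_hodgeClasses_hodge_tensor_eq_sum' hHD hT hT' hTT' 4 2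
  rw [show antidiagonal 4 = {(0, 4), (1, 3), (2, 2), (3, 1), (4, 0)} from by decide, Finset.sum_insert (by decide), Finset.sum_insert (by decide),
    Finset.sum_insert (by decide), Finset.sum_insert (by decide), Finset.sum_singleton] at h
  have e04 : Module.finrank ℚ ↥(((BettiUniverse.hodge hHD hT 0).tensor (BettiUniverse.hodge hHD hT' 4)).hodgeClasses 2) =
      Module.finrank ℚ ↥((BettiUniverse.hodge hHD hT' 4).hodgeClasses 2) :=
    BettiUniverse.finrank_hodgeClasses_tensor_hodge_zero_left hHD hT hT' 4 2
  have e40 : Module.finrank ℚ ↥(((BettiUniverse.hodge hHD hT 4).tensor (BettiUniverse.hodge hHD hT' 0)).hodgeClasses 2) =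
      Module.finrank ℚ ↥((BettiUniverse.hodge hHD hT 4).hodgeClasses 2) :=
    BettiUniverse.finrank_hodgeClasses_tensor_hodge_zero_right hHD hT hT' 4 2
  have e13 : Module.finrank ℚ ↥(((BettiUniverse.hodge hHD hT 1).tensor (BettiUniverse.hodge hHD hT' 3)).hodgeClasses 2) =
      Module.finrank ℚ (HodgeStructure.Hom (BettiUniverse.hodge hHD hT 1) (((BettiUniverse.hodge hHD hT' 3).tateTwist 1).cast (by norm_num))) := by
    have e := BettiUniverse.finrank_hodgeClasses_tensor_hodge_eq_finrank_hom_tateTwist hHD hT hT' 1 3 (s := 1) (by norm_num)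
    rw [show (((1 : ℕ) : ℤ) + 1) = 2 by norm_num] at e
    exact e
  have e31 : Module.finrank ℚ ↥(((BettiUniverse.hodge hHD hT 3).tensor (BettiUniverse.hodge hHD hT' 1)).hodgeClasses 2) =
      Module.finrank ℚ (HodgeStructure.Hom (BettiUniverse.hodge hHD hT 3) (((BettiUniverse.hodge hHD hT' 1).tateTwist (-1)).cast (by norm_num))) := by
    have e := BettiUniverse.finrank_hodgeClasses_tensor_hodge_eq_finrank_hom_tateTwist hHD hT hT' 3 1 (s := -1) (by norm_num)
    rw [show (((3 : ℕ) : ℤ) + -1) = 2 by norm_num] at e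
    exact e
  have e22 : Module.finrank ℚ ↥(((BettiUniverse.hodge hHD hT 2).tensor (BettiUniverse.hodge hHD hT' 2)).hodgeClasses 2) =
      Module.finrank ℚ (HodgeStructure.Hom (BettiUniverse.hodge hHD hT 2) (BettiUniverse.hodge hHD hT' 2)) :=
    BettiUniverse.finrank_hodgeClasses_tensor_hodge_eq_finrank_hom hHD hT hT' 2
  have h' : Module.finrank ℚ ↥((BettiUniverse.hodge hHD hTT' 4).hodgeClasses 2) =
      Module.finrank ℚ ↥(((BettiUniverse.hodge hHD hT 0).tensor (BettiUniverse.hodge hHD hT' 4)).hodgeClasses 2) +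
        (Module.finrank ℚ ↥(((BettiUniverse.hodge hHD hT 1).tensor (BettiUniverse.hodge hHD hT' 3)).hodgeClasses 2) +
          (Module.finrank ℚ ↥(((BettiUniverse.hodge hHD hT 2).tensor (BettiUniverse.hodge hHD hT' 2)).hodgeClasses 2) +
            (Module.finrank ℚ ↥(((BettiUniverse.hodge hHD hT 3).tensor (BettiUniverse.hodge hHD hT' 1)).hodgeClasses 2) +
              Module.finrank ℚ ↥(((BettiUniverse.hodge hHD hT 4).tensor (BettiUniverse.hodge hHD hT' 0)).hodgeClasses 2)))) := h
  rw [h', e04, e13, e22, e31, e40]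
  ring

/-! ### §2 The seven pieces of `H⁶(T ⊗ T')` -/

/-- **`dim_ℚ Hdg³(H⁶(T ⊗ T')) = 1 + dim Hom_HS(H¹(T), H⁵(T')(2)) + dim Hom_HS(H²(T), H⁴(T')(1)) + dim Hom_HS(H³(T), H³(T')) + dim Hom_HS(H⁴(T), H²(T')(−1)) + dim Hom_HS(H⁵(T), H¹(T')(−2)) + 1`**
for two smooth projective threefolds (any smooth-projective structure on the product): Künneth (Thm. 11.38), the outer pieces `H⁰ ⊗ H⁶`, `H⁶ ⊗ H⁰` are lines (`Hdg³(H⁶) = H⁶`), the five inner ones by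
Lemma 11.41 (g27-#7). [cite: VoisinHodgeI2002, §11.3.3 Thm. 11.38, Thm. 11.40, Lemma 11.41 (pp. 285–286) and p. 287] [cite: DeligneHodgeII1971, 2.1.13–2.1.14] -/
theorem BettiUniverse.finrank_hodgeClasses_hodge_six_tensor_threefolds (hHD : exists_isReal_hodgeModel) (hT : IsSmoothProjective 3 T) (hT' : IsSmoothProjective 3 T')
    (hTT' : IsSmoothProjective d (T ⊗ T')) :
    Module.finrank ℚ ↥((BettiUniverse.hodge hHD hTT' 6).hodgeClasses 3) =
      1 + Module.finrank ℚ (HodgeStructure.Hom (BettiUniverse.hodge hHD hT 1) (((BettiUniverse.hodge hHD hT' 5).tateTwist 2).cast (by norm_num))) +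
        Module.finrank ℚ (HodgeStructure.Hom (BettiUniverse.hodge hHD hT 2) (((BettiUniverse.hodge hHD hT' 4).tateTwist 1).cast (by norm_num))) +
          Module.finrank ℚ (HodgeStructure.Hom (BettiUniverse.hodge hHD hT 3) (BettiUniverse.hodge hHD hT' 3)) +
            Module.finrank ℚ (HodgeStructure.Hom (BettiUniverse.hodge hHD hT 4) (((BettiUniverse.hodge hHD hT' 2).tateTwist (-1)).cast (by norm_num))) +
              Module.finrank ℚ (HodgeStructure.Hom (BettiUniverse.hodge hHD hT 5) (((BettiUniverse.hodge hHD hT' 1).tateTwist (-2)).cast (by norm_num))) + 1 := by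
  have h := BettiUniverse.finrank_hodgeClasses_hodge_tensor_eq_sum' hHD hT hT' hTT' 6 3
  rw [show antidiagonal 6 = {(0, 6), (1, 5), (2, 4), (3, 3), (4, 2), (5, 1), (6, 0)} from by decide, Finset.sum_insert (by decide), Finset.sum_insert (by decide),
    Finset.sum_insert (by decide), Finset.sum_insert (by decide), Finset.sum_insert (by decide), Finset.sum_insert (by decide), Finset.sum_singleton] at h
  have e06 : Module.finrank ℚ ↥(((BettiUniverse.hodge hHD hT 0).tensor (BettiUniverse.hodge hHD hT' 6)).hodgeClasses 3) = 1 := by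
    rw [BettiUniverse.finrank_hodgeClasses_tensor_hodge_zero_left hHD hT hT' 6 3]; exact BettiUniverse.finrank_hodgeClasses_hodge_six_threefold hHD hT'
  have e60 : Module.finrank ℚ ↥(((BettiUniverse.hodge hHD hT 6).tensor (BettiUniverse.hodge hHD hT' 0)).hodgeClasses 3) = 1 := by
    rw [BettiUniverse.finrank_hodgeClasses_tensor_hodge_zero_right hHD hT hT' 6 3]; exact BettiUniverse.finrank_hodgeClasses_hodge_six_threefold hHD hT
  have e15 : Module.finrank ℚ ↥(((BettiUniverse.hodge hHD hT 1).tensor (BettiUniverse.hodge hHD hT' 5)).hodgeClasses 3) =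
      Module.finrank ℚ (HodgeStructure.Hom (BettiUniverse.hodge hHD hT 1) (((BettiUniverse.hodge hHD hT' 5).tateTwist 2).cast (by norm_num))) := by
    have e := BettiUniverse.finrank_hodgeClasses_tensor_hodge_eq_finrank_hom_tateTwist hHD hT hT' 1 5 (s := 2) (by norm_num)
    rw [show (((1 : ℕ) : ℤ) + 2) = 3 by norm_num] at e
    exact e
  have e24 : Module.finrank ℚ ↥(((BettiUniverse.hodge hHD hT 2).tensor (BettiUniverse.hodge hHD hT' 4)).hodgeClasses 3) =
      Module.finrank ℚ (HodgeStructure.Hom (BettiUniverse.hodge hHD hT 2) (((BettiUniverse.hodge hHD hT' 4).tateTwist 1).cast (by norm_num))) := by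
    have e := BettiUniverse.finrank_hodgeClasses_tensor_hodge_eq_finrank_hom_tateTwist hHD hT hT' 2 4 (s := 1) (by norm_num)
    rw [show (((2 : ℕ) : ℤ) + 1) = 3 by norm_num] at e
    exact e
  have e33 : Module.finrank ℚ ↥(((BettiUniverse.hodge hHD hT 3).tensor (BettiUniverse.hodge hHD hT' 3)).hodgeClasses 3) =
      Module.finrank ℚ (HodgeStructure.Hom (BettiUniverse.hodge hHD hT 3) (BettiUniverse.hodge hHD hT' 3)) :=
    BettiUniverse.finrank_hodgeClasses_tensor_hodge_eq_finrank_hom hHD hT hT' 3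
  have e42 : Module.finrank ℚ ↥(((BettiUniverse.hodge hHD hT 4).tensor (BettiUniverse.hodge hHD hT' 2)).hodgeClasses 3) =
      Module.finrank ℚ (HodgeStructure.Hom (BettiUniverse.hodge hHD hT 4) (((BettiUniverse.hodge hHD hT' 2).tateTwist (-1)).cast (by norm_num))) := by
    have e := BettiUniverse.finrank_hodgeClasses_tensor_hodge_eq_finrank_hom_tateTwist hHD hT hT' 4 2 (s := -1) (by norm_num)
    rw [show (((4 : ℕ) : ℤ) + -1) = 3 by norm_num] at e
    exact e
  have e51 : Module.finrank ℚ ↥(((BettiUniverse.hodge hHD hT 5).tensor (BettiUniverse.hodge hHD hT' 1)).hodgeClasses 3) =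
      Module.finrank ℚ (HodgeStructure.Hom (BettiUniverse.hodge hHD hT 5) (((BettiUniverse.hodge hHD hT' 1).tateTwist (-2)).cast (by norm_num))) := by
    have e := BettiUniverse.finrank_hodgeClasses_tensor_hodge_eq_finrank_hom_tateTwist hHD hT hT' 5 1 (s := -2) (by norm_num)
    rw [show (((5 : ℕ) : ℤ) + -2) = 3 by norm_num] at e
    exact e
  have h' : Module.finrank ℚ ↥((BettiUniverse.hodge hHD hTT' 6).hodgeClasses 3) =
      Module.finrank ℚ ↥(((BettiUniverse.hodge hHD hT 0).tensor (BettiUniverse.hodge hHD hT' 6)).hodgeClasses 3) +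
        (Module.finrank ℚ ↥(((BettiUniverse.hodge hHD hT 1).tensor (BettiUniverse.hodge hHD hT' 5)).hodgeClasses 3) +
          (Module.finrank ℚ ↥(((BettiUniverse.hodge hHD hT 2).tensor (BettiUniverse.hodge hHD hT' 4)).hodgeClasses 3) +
            (Module.finrank ℚ ↥(((BettiUniverse.hodge hHD hT 3).tensor (BettiUniverse.hodge hHD hT' 3)).hodgeClasses 3) +
              (Module.finrank ℚ ↥(((BettiUniverse.hodge hHD hT 4).tensor (BettiUniverse.hodge hHD hT' 2)).hodgeClasses 3) +
                (Module.finrank ℚ ↥(((BettiUniverse.hodge hHD hT 5).tensor (BettiUniverse.hodge hHD hT' 1)).hodgeClasses 3) +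
                  Module.finrank ℚ ↥(((BettiUniverse.hodge hHD hT 6).tensor (BettiUniverse.hodge hHD hT' 0)).hodgeClasses 3)))))) := h
  rw [h', e06, e15, e24, e33, e42, e51, e60]
  ring

/-! ### §3 The Hodge conjecture for `T × T'` -/

/-- **`HC(T ⊗ T')` for smooth projective threefolds `T`, `T'` whose product carries no exceptional Hodge classes in the language of Lemma 11.41:** the odd-piece morphisms
`H¹(T) → H³(T')(1)`, `H³(T) → H¹(T')(−1)`, `H¹(T) → H⁵(T')(2)`, `H³(T) → H³(T')`, `H⁵(T) → H¹(T')(−2)` vanish, and the even-piece morphisms are no more than the rank-one ones through Hodge classes: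
`dim Hom_HS(H²(T), H²(T')) ≤ ρ(T) ρ(T')`, `dim Hom_HS(H²(T), H⁴(T')(1)) ≤ ρ(T) · dim Hdg²(H⁴(T'))`, `dim Hom_HS(H⁴(T), H²(T')(−1)) ≤ dim Hdg²(H⁴(T)) · ρ(T')` (then all three are equalities).  `HC(T)`,
`HC(T')` hold in dimension `3`. [cite: VoisinHodgeI2002, §11.3.3 Lemma 11.41, p. 287, Thm. 11.30 and Thm. 6.25] [cite: Deligne2000, §1] -/
theorem BettiUniverse.hodgeConjectureFor_tensor_threefolds_of_hom (hHD : exists_isReal_hodgeModel) (hT : IsSmoothProjective 3 T) (hT' : IsSmoothProjective 3 T')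
    (hTT' : IsSmoothProjective 6 (T ⊗ T'))
    (h13 : Subsingleton (HodgeStructure.Hom (BettiUniverse.hodge hHD hT 1) (((BettiUniverse.hodge hHD hT' 3).tateTwist 1).cast (by norm_num))))
    (h31 : Subsingleton (HodgeStructure.Hom (BettiUniverse.hodge hHD hT 3) (((BettiUniverse.hodge hHD hT' 1).tateTwist (-1)).cast (by norm_num))))
    (h22 : Module.finrank ℚ (HodgeStructure.Hom (BettiUniverse.hodge hHD hT 2) (BettiUniverse.hodge hHD hT' 2)) ≤
      Module.finrank ℚ ↥((BettiUniverse.hodge hHD hT 2).hodgeClasses 1) * Module.finrank ℚ ↥((BettiUniverse.hodge hHD hT' 2).hodgeClasses 1))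
    (h15 : Subsingleton (HodgeStructure.Hom (BettiUniverse.hodge hHD hT 1) (((BettiUniverse.hodge hHD hT' 5).tateTwist 2).cast (by norm_num))))
    (h33 : Subsingleton (HodgeStructure.Hom (BettiUniverse.hodge hHD hT 3) (BettiUniverse.hodge hHD hT' 3)))
    (h51 : Subsingleton (HodgeStructure.Hom (BettiUniverse.hodge hHD hT 5) (((BettiUniverse.hodge hHD hT' 1).tateTwist (-2)).cast (by norm_num))))
    (h24 : Module.finrank ℚ (HodgeStructure.Hom (BettiUniverse.hodge hHD hT 2) (((BettiUniverse.hodge hHD hT' 4).tateTwist 1).cast (by norm_num))) ≤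
      Module.finrank ℚ ↥((BettiUniverse.hodge hHD hT 2).hodgeClasses 1) * Module.finrank ℚ ↥((BettiUniverse.hodge hHD hT' 4).hodgeClasses 2))
    (h42 : Module.finrank ℚ (HodgeStructure.Hom (BettiUniverse.hodge hHD hT 4) (((BettiUniverse.hodge hHD hT' 2).tateTwist (-1)).cast (by norm_num))) ≤
      Module.finrank ℚ ↥((BettiUniverse.hodge hHD hT 4).hodgeClasses 2) * Module.finrank ℚ ↥((BettiUniverse.hodge hHD hT' 2).hodgeClasses 1)) :
    HodgeConjectureFor 6 (T ⊗ T') := by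
  refine BettiUniverse.hodgeConjectureFor_tensor_of_finrank_eq_sum_of_two_le hHD hT hT' hTT' (fun P hP2 hP6 ↦ ?_)
    (hodgeConjectureFor_of_dim_le_three_holds le_rfl hT) (hodgeConjectureFor_of_dim_le_three_holds le_rfl hT')
  haveI := BettiUniverse.finite hT (2 * 0)
  haveI := BettiUniverse.finite hT' (2 * 0)
  have t0 : Module.finrank ℚ ↥((BettiUniverse.hodge hHD hT (2 * 0)).hodgeClasses ((0 : ℕ) : ℤ)) = 1 := by
    have e : (BettiUniverse.hodge hHD hT (2 * 0)).hodgeClasses ((0 : ℕ) : ℤ) = ⊤ := BettiUniverse.hodgeClasses_hodge_zero_eq_top hHD hT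
    rw [e, finrank_top]; exact BettiUniverse.finrank_bettiCohomology_zero hT
  have t0' : Module.finrank ℚ ↥((BettiUniverse.hodge hHD hT' (2 * 0)).hodgeClasses ((0 : ℕ) : ℤ)) = 1 := by
    have e : (BettiUniverse.hodge hHD hT' (2 * 0)).hodgeClasses ((0 : ℕ) : ℤ) = ⊤ := BettiUniverse.hodgeClasses_hodge_zero_eq_top hHD hT'
    rw [e, finrank_top]; exact BettiUniverse.finrank_bettiCohomology_zero hT'
  obtain rfl | rfl : P = 2 ∨ P = 3 := by omega
  · -- codimension 2: the five pieces of `H⁴`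
    have h22' := le_antisymm h22 (BettiUniverse.picardNumber_mul_le_finrank_hom_hodge_two hHD hT hT')
    have z13 : Module.finrank ℚ (HodgeStructure.Hom (BettiUniverse.hodge hHD hT 1) (((BettiUniverse.hodge hHD hT' 3).tateTwist 1).cast (by norm_num))) = 0 :=
      Module.finrank_zero_of_subsingleton
    have z31 : Module.finrank ℚ (HodgeStructure.Hom (BettiUniverse.hodge hHD hT 3) (((BettiUniverse.hodge hHD hT' 1).tateTwist (-1)).cast (by norm_num))) = 0 :=
      Module.finrank_zero_of_subsingleton
    have hcount := BettiUniverse.finrank_hodgeClasses_hodge_four_tensor_threefolds hHD hT hT' hTT'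
    rw [z13, z31, h22', add_zero, add_zero] at hcount
    rw [show antidiagonal 2 = {(0, 2), (1, 1), (2, 0)} from by decide, Finset.sum_insert (by decide), Finset.sum_insert (by decide), Finset.sum_singleton]
    show _ = Module.finrank ℚ ↥((BettiUniverse.hodge hHD hT (2 * 0)).hodgeClasses ((0 : ℕ) : ℤ)) * Module.finrank ℚ ↥((BettiUniverse.hodge hHD hT' (2 * 2)).hodgeClasses ((2 : ℕ) : ℤ)) +
        (Module.finrank ℚ ↥((BettiUniverse.hodge hHD hT (2 * 1)).hodgeClasses ((1 : ℕ) : ℤ)) * Module.finrank ℚ ↥((BettiUniverse.hodge hHD hT' (2 * 1)).hodgeClasses ((1 : ℕ) : ℤ)) +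
          Module.finrank ℚ ↥((BettiUniverse.hodge hHD hT (2 * 2)).hodgeClasses ((2 : ℕ) : ℤ)) * Module.finrank ℚ ↥((BettiUniverse.hodge hHD hT' (2 * 0)).hodgeClasses ((0 : ℕ) : ℤ)))
    have hc' : Module.finrank ℚ ↥((BettiUniverse.hodge hHD hTT' (2 * 2)).hodgeClasses ((2 : ℕ) : ℤ)) =
        Module.finrank ℚ ↥((BettiUniverse.hodge hHD hT' (2 * 2)).hodgeClasses ((2 : ℕ) : ℤ)) +
          Module.finrank ℚ ↥((BettiUniverse.hodge hHD hT (2 * 1)).hodgeClasses ((1 : ℕ) : ℤ)) * Module.finrank ℚ ↥((BettiUniverse.hodge hHD hT' (2 * 1)).hodgeClasses ((1 : ℕ) : ℤ)) +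
            Module.finrank ℚ ↥((BettiUniverse.hodge hHD hT (2 * 2)).hodgeClasses ((2 : ℕ) : ℤ)) := hcount
    rw [t0, t0', Nat.one_mul (Module.finrank ℚ _), Nat.mul_one (Module.finrank ℚ _), hc']
    ring
  · -- codimension 3: the seven pieces of `H⁶`
    have l24 : Module.finrank ℚ ↥((BettiUniverse.hodge hHD hT 2).hodgeClasses 1) * Module.finrank ℚ ↥((BettiUniverse.hodge hHD hT' 4).hodgeClasses 2) ≤
        Module.finrank ℚ (HodgeStructure.Hom (BettiUniverse.hodge hHD hT 2) (((BettiUniverse.hodge hHD hT' 4).tateTwist 1).cast (by norm_num))) :=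
      BettiUniverse.finrank_hodgeClasses_mul_le_finrank_hom_tateTwist hHD hT hT' 1 2
    have l42 : Module.finrank ℚ ↥((BettiUniverse.hodge hHD hT 4).hodgeClasses 2) * Module.finrank ℚ ↥((BettiUniverse.hodge hHD hT' 2).hodgeClasses 1) ≤
        Module.finrank ℚ (HodgeStructure.Hom (BettiUniverse.hodge hHD hT 4) (((BettiUniverse.hodge hHD hT' 2).tateTwist (-1)).cast (by norm_num))) :=
      BettiUniverse.finrank_hodgeClasses_mul_le_finrank_hom_tateTwist hHD hT hT' 2 1
    have h24' := le_antisymm h24 l24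
    have h42' := le_antisymm h42 l42
    have z15 : Module.finrank ℚ (HodgeStructure.Hom (BettiUniverse.hodge hHD hT 1) (((BettiUniverse.hodge hHD hT' 5).tateTwist 2).cast (by norm_num))) = 0 :=
      Module.finrank_zero_of_subsingleton
    have z33 : Module.finrank ℚ (HodgeStructure.Hom (BettiUniverse.hodge hHD hT 3) (BettiUniverse.hodge hHD hT' 3)) = 0 := Module.finrank_zero_of_subsingleton
    have z51 : Module.finrank ℚ (HodgeStructure.Hom (BettiUniverse.hodge hHD hT 5) (((BettiUniverse.hodge hHD hT' 1).tateTwist (-2)).cast (by norm_num))) = 0 :=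
      Module.finrank_zero_of_subsingleton
    have hcount := BettiUniverse.finrank_hodgeClasses_hodge_six_tensor_threefolds hHD hT hT' hTT'
    rw [z15, z33, z51, h24', h42', add_zero, add_zero, add_zero] at hcount
    rw [show antidiagonal 3 = {(0, 3), (1, 2), (2, 1), (3, 0)} from by decide, Finset.sum_insert (by decide), Finset.sum_insert (by decide), Finset.sum_insert (by decide),
      Finset.sum_singleton]
    have t3 : Module.finrank ℚ ↥((BettiUniverse.hodge hHD hT (2 * 3)).hodgeClasses ((3 : ℕ) : ℤ)) = 1 := BettiUniverse.finrank_hodgeClasses_hodge_six_threefold hHD hT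
    have t3' : Module.finrank ℚ ↥((BettiUniverse.hodge hHD hT' (2 * 3)).hodgeClasses ((3 : ℕ) : ℤ)) = 1 := BettiUniverse.finrank_hodgeClasses_hodge_six_threefold hHD hT'
    show _ = Module.finrank ℚ ↥((BettiUniverse.hodge hHD hT (2 * 0)).hodgeClasses ((0 : ℕ) : ℤ)) * Module.finrank ℚ ↥((BettiUniverse.hodge hHD hT' (2 * 3)).hodgeClasses ((3 : ℕ) : ℤ)) +
        (Module.finrank ℚ ↥((BettiUniverse.hodge hHD hT (2 * 1)).hodgeClasses ((1 : ℕ) : ℤ)) * Module.finrank ℚ ↥((BettiUniverse.hodge hHD hT' (2 * 2)).hodgeClasses ((2 : ℕ) : ℤ)) +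
          (Module.finrank ℚ ↥((BettiUniverse.hodge hHD hT (2 * 2)).hodgeClasses ((2 : ℕ) : ℤ)) * Module.finrank ℚ ↥((BettiUniverse.hodge hHD hT' (2 * 1)).hodgeClasses ((1 : ℕ) : ℤ)) +
            Module.finrank ℚ ↥((BettiUniverse.hodge hHD hT (2 * 3)).hodgeClasses ((3 : ℕ) : ℤ)) * Module.finrank ℚ ↥((BettiUniverse.hodge hHD hT' (2 * 0)).hodgeClasses ((0 : ℕ) : ℤ))))
    have hc' : Module.finrank ℚ ↥((BettiUniverse.hodge hHD hTT' (2 * 3)).hodgeClasses ((3 : ℕ) : ℤ)) =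
        1 + Module.finrank ℚ ↥((BettiUniverse.hodge hHD hT (2 * 1)).hodgeClasses ((1 : ℕ) : ℤ)) * Module.finrank ℚ ↥((BettiUniverse.hodge hHD hT' (2 * 2)).hodgeClasses ((2 : ℕ) : ℤ)) +
          Module.finrank ℚ ↥((BettiUniverse.hodge hHD hT (2 * 2)).hodgeClasses ((2 : ℕ) : ℤ)) * Module.finrank ℚ ↥((BettiUniverse.hodge hHD hT' (2 * 1)).hodgeClasses ((1 : ℕ) : ℤ)) + 1 := hcount
    rw [t0, t0', t3, t3', Nat.one_mul (1 : ℕ), hc']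
    ring

/-- **`HC(T ⊗ T')` for threefolds with `q(T) = q(T') = 0`** (so `H¹ = H⁵ = 0` on both sides and four of the five odd conditions are automatic) **when `Hom_HS(H³(T), H³(T')) = 0` and the three even
`Hom` are the rank-one ones** (`dim Hom_HS(H²(T), H²(T')) ≤ ρρ'`, `dim Hom_HS(H²(T), H⁴(T')(1)) ≤ ρ(T) · dim Hdg²(H⁴(T'))`, `dim Hom_HS(H⁴(T), H²(T')(−1)) ≤ dim Hdg²(H⁴(T)) · ρ(T')`): e.g. two regular
threefolds with `p_g`-type classes but no transcendental morphisms between their `H²`/`H⁴` and `H³`. [cite: VoisinHodgeI2002, §11.3.3 Lemma 11.41, p. 287, Thm. 11.30, §6.1.3 Cor. 6.13 and Thm. 6.25]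
[cite: Deligne2000, §1] -/
theorem BettiUniverse.hodgeConjectureFor_tensor_threefolds_of_q_zero_of_hom (hHD : exists_isReal_hodgeModel) (hT : IsSmoothProjective 3 T) (hT' : IsSmoothProjective 3 T')
    (hTT' : IsSmoothProjective 6 (T ⊗ T')) (hq : (BettiUniverse.hodge hHD hT 1).hodgeNumber 1 0 = 0) (hq' : (BettiUniverse.hodge hHD hT' 1).hodgeNumber 1 0 = 0)
    (h22 : Module.finrank ℚ (HodgeStructure.Hom (BettiUniverse.hodge hHD hT 2) (BettiUniverse.hodge hHD hT' 2)) ≤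
      Module.finrank ℚ ↥((BettiUniverse.hodge hHD hT 2).hodgeClasses 1) * Module.finrank ℚ ↥((BettiUniverse.hodge hHD hT' 2).hodgeClasses 1))
    (h33 : Subsingleton (HodgeStructure.Hom (BettiUniverse.hodge hHD hT 3) (BettiUniverse.hodge hHD hT' 3)))
    (h24 : Module.finrank ℚ (HodgeStructure.Hom (BettiUniverse.hodge hHD hT 2) (((BettiUniverse.hodge hHD hT' 4).tateTwist 1).cast (by norm_num))) ≤
      Module.finrank ℚ ↥((BettiUniverse.hodge hHD hT 2).hodgeClasses 1) * Module.finrank ℚ ↥((BettiUniverse.hodge hHD hT' 4).hodgeClasses 2))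
    (h42 : Module.finrank ℚ (HodgeStructure.Hom (BettiUniverse.hodge hHD hT 4) (((BettiUniverse.hodge hHD hT' 2).tateTwist (-1)).cast (by norm_num))) ≤
      Module.finrank ℚ ↥((BettiUniverse.hodge hHD hT 4).hodgeClasses 2) * Module.finrank ℚ ↥((BettiUniverse.hodge hHD hT' 2).hodgeClasses 1)) :
    HodgeConjectureFor 6 (T ⊗ T') := by
  haveI := BettiUniverse.finite hT 1
  haveI := BettiUniverse.finite hT 5
  haveI := BettiUniverse.finite hT' 1
  have h1 : Module.finrank ℚ (bettiCohomology T 1) = 0 := (BettiUniverse.finrank_bettiCohomology_one_eq_zero_iff hHD hT).2 hq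
  have h5 : Module.finrank ℚ (bettiCohomology T 5) = 0 := by
    rw [BettiUniverse.finrank_bettiCohomology_eq_of_add_eq hT (k := 5) (l := 1) (by norm_num)]; exact h1
  have h1' : Module.finrank ℚ (bettiCohomology T' 1) = 0 := (BettiUniverse.finrank_bettiCohomology_one_eq_zero_iff hHD hT').2 hq'
  haveI : Subsingleton (bettiCohomology T 1) := Module.finrank_zero_iff.1 h1
  haveI : Subsingleton (bettiCohomology T 5) := Module.finrank_zero_iff.1 h5
  haveI : Subsingleton (bettiCohomology T' 1) := Module.finrank_zero_iff.1 h1'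
  exact BettiUniverse.hodgeConjectureFor_tensor_threefolds_of_hom hHD hT hT' hTT'
    HodgeStructure.Hom.toLinearMap_injective.subsingleton HodgeStructure.Hom.toLinearMap_injective.subsingleton h22
    HodgeStructure.Hom.toLinearMap_injective.subsingleton h33 HodgeStructure.Hom.toLinearMap_injective.subsingleton h24 h42

end Threefolds

end Literature.AlgebraicGeometry.HodgeTheory

end
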